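/-
Copyright (c) 2026 the pub-hodgecm-mathlib formalisation cell (harness21).  Prover seat hodgecm-mathlib-B-p04 (g48): LH4-plan (g6) WORD #124 «GO, STAGED», head (H′) = the WILD
unit-discriminant twin of ★ (D5) `TypeTwoUnitIndexAtPlace` (F0P3a-p08 g18) on the Eisenstein engine (L1′)(L2′)(L3′); 2026-09-02.
-/
import Literature.NumberTheory.Automorphic.QuadraticEisensteinOrderNormIndex     -- (L3′) p851869 (this seat): `relIndex_units_comap_norm_eq_eisenstein`; brings (L1′) p851849, (L2′) p851856
import Literature.NumberTheory.Rogawski1990.TypeTwoUnitIndexAtPlace              -- ★ (D5) (F0P3a-p08): `exists_integer_ringHom_of_map_mem_integer` + the place dictionary it imports (★ Σ2-CM, ★ unit norms at an inert place, ★ `valued_toPlace_of_isUnramifiedIn`)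
import HarnessLib

/-!
# (D5)′ «[T2-c] DISCHARGE AT THE PLACE», WILD UNIT-DISCRIMINANT ROW: the type-(2) unit index `[C : R^×] = (N(v)+1)·N(v)^{N+k−e+n−1}` at an inert-unramified DYADIC place

Topic `NumberTheory/Rogawski1990`; namespace `Literature.NumberTheory.Rogawski1990`.  ONE THEOREM (no definition, no instance, no notation, no named fact, no `sorry`); kernel lane
`--supports stmt-HodgeConjecture-24833`.  Cell `pub/hodgecm-mathlib` (D-0151), crux H413; LH4-plan (g6) price list, B-p04 (g47) memo `MEMO-M4-wild-parity.v1` (4adf46b3) **§4 (c)-CONSUMER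
row «`TypeTwoUnitIndexAtPlace` at a wild unit row», level `N′ = N + k − ord_v 2`** (census B-p04 (g48) 959b1194): the place plumbing of ★ (D5) `exists_integers_relIndex_units_comap_norm_eq_place`
re-run on the conclusion of ★ (D2-β)′ `TypeTwoEigenFieldPackage­Wild.exists_eigenField_package_wildUnit` (p851792) through the EISENSTEIN engine (L1′) p851849, (L2′) p851856, (L3′) p851869.
Frame: `E ∕ F` quadratic number fields, `c ≠ 1`, `v` unramified in `E`, `w ∣ v` with `c • w = w`, `|2|_v = exp(−e)`; `K = M_{w₁}` for a quadratic `M ⊃ E` WILDLY ramified at `w` with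
the (D2-β)′ package: `α² = ι₁ι d`, `d = 1 + w₀`, `|w₀|_v = exp(−(2k+1))`, `|4|_v < |w₀|_v`, Eisenstein coordinates on `(1, Π)`, `Π = (α − 1)∕ι₁ιϖ^k`, integrality criterion, the involution
`s̃` over `σ` fixing `α`, unit norms (nK); eigen-data `u t D y e₂` (`e₂·2 = 1`, `4D = t² − y²ιd`, unitarity relations, `ord χ(u) = n`, `ord y = N`, `|1 − t + D| < 1`) and the two package
clauses on `λ₁ = e₂(t + yα)`: `λ₁ ∈ 𝒪[K]`, `|λ₁ − 1| < 1`.  DIFFERENCES from ★ (D5): `h2 : |2|_w = 1` DROPPED (so `e₂ ∉ 𝒪_w` and there is no `e₂O`); `θ ↦ α` with `α` a UNIT, the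
integral basis being the Eisenstein uniformiser `Π` (`Π² = ι(−2∕ϖ^k)·Π + ι(w₀∕ϖ^{2k})`); the generator `λ₁` has integral coordinates `p = e₂(t + y)`, **`q = e₂·y·ιϖ^k` of order
`N′ = N + k − e`**; OUTPUT: the integral ring maps, the integral lifts `uO tO yO DO pO qO`, `piO`, `lamO = jO pO + jO qO·piO`, the bound `e ≤ N + k`, and the INDEX
**`[C : R^×] = (N(v) + 1)·N(v)^{N+k−e+n−1}`** for `R = 𝒪_w[(u, λ₁)] ≤ 𝒪_w × 𝒪[K]`, `C = {c : c·c⋆ ∈ R^×}` (side condition `1 ≤ N + k − e + n`).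
HONEST LABEL: HC_CM is proved only modulo the 7 printed citations (2 remaining named inputs: hLiu418 = stmt-HodgeConjecture-24832, h413 = stmt-HodgeConjecture-24833) until rung 0 closes;
unconditional local algebra, count-neutral ((D-UNR) PRINT; pays no organ, opens no road).

* **`exists_integers_relIndex_units_comap_norm_eq_place_wildUnit`** — (D5)′.

## References
* [Rogawski1990] J. D. Rogawski, *Automorphic Representations of Unitary Groups in Three Variables* (1990): §4.9 Lemma 4.9.3 p. 56, Prop. 4.9.1 (b) p. 55.
* [SerreLocalFields1979] J.-P. Serre, *Local Fields*, GTM 67 (1979): Ch. I §6 Prop. 17–18; Ch. II §5 (Eisenstein); Ch. V §2 Prop. 3 and Corollary.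
* [Neukirch1999] J. Neukirch, *Algebraic Number Theory*, Grundlehren 322 (1999): Ch. I §12; Ch. II §4 Prop. (4.3).
-/

set_option autoImplicit false

noncomputable section

open ValuativeRel NumberField IsDedekindDomain Polynomial
open scoped ValuativeRel
open Literature.NumberTheory.Automorphic Literature.NumberTheory.Automorphic.UnitaryGroup

namespace Literature.NumberTheory.Rogawski1990

set_option maxHeartbeats 4000000 in
/-- **(D5)′ «[T2-c] DISCHARGE AT THE PLACE», WILD UNIT-DISCRIMINANT ROW** — see the module docstring.  Frame: `E ∕ F` quadratic number fields, `c ≠ 1`, `v` unramified in `E`, `w ∣ v` with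
`c • w = w`, `|2|_v = exp(−e)` (dyadic allowed); `K = M_{w₁}` for a quadratic `M ⊃ E` wildly ramified at `w` with the (D2-β)′ package `(α, s̃)` over `d = 1 + w₀` (★ p851792's conclusion,
conjunct by conjunct); eigen-data `u t D y e₂` with `λ₁ = e₂(t + yα)` integral and `≡ 1`.  Level `N′ = N + k − e`.
[cite: Rogawski1990, §4.9 Lemma 4.9.3 p. 56; Prop. 4.9.1 (b) p. 55] [cite: SerreLocalFields1979, Ch. II §5; Ch. V §2 Prop. 3 and Corollary] [cite: Neukirch1999, Ch. I §12] -/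
theorem exists_integers_relIndex_units_comap_norm_eq_place_wildUnit
    {F E : Type} [Field F] [NumberField F] [Field E] [NumberField E] [Algebra F E] [Algebra.IsQuadraticExtension F E]
    (c : E ≃ₐ[F] E) (v : HeightOneSpectrum (𝓞 F)) (hc : c ≠ 1) (hunr : Algebra.IsUnramifiedIn (𝓞 E) v.asIdeal)
    (w : PlacesOver E v) (hw : c • w.1 = w.1) {e : ℕ} (he : Valued.v (2 : v.adicCompletion F) = WithZero.exp (-(e : ℤ)))
    -- the wild unit discriminant `d = 1 + w₀` and the uniformiser `ϖ` of `F_v`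
    {d w₀ : v.adicCompletion F} (hdw : d = 1 + w₀) {k : ℕ} (hw₀ : Valued.v w₀ = WithZero.exp (-(2 * (k : ℤ) + 1)))
    (h4 : Valued.v (4 : v.adicCompletion F) < Valued.v w₀) {ϖ : v.adicCompletion F} (hϖ : Valued.v ϖ = WithZero.exp (-1 : ℤ))
    -- the ramified eigen-field `K = M_{w₁}` and its (D2-β)′ package over `d`
    {M : Type} [Field M] [NumberField M] [Algebra E M] (w₁ : PlacesOver M w.1)
    {α : w₁.1.adicCompletion M} (s' : w₁.1.adicCompletion M →+* w₁.1.adicCompletion M)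
    (hα : α ^ 2 = toPlace w.1 w₁ (toPlace v w d))
    (hcoord : ∀ z : w₁.1.adicCompletion M, ∃! pq : w.1.adicCompletion E × w.1.adicCompletion E,
      z = toPlace w.1 w₁ pq.1 + toPlace w.1 w₁ pq.2 * ((α - 1) / toPlace w.1 w₁ (toPlace v w ϖ) ^ k))
    (hint : ∀ p q : w.1.adicCompletion E, toPlace w.1 w₁ p + toPlace w.1 w₁ q * ((α - 1) / toPlace w.1 w₁ (toPlace v w ϖ) ^ k) ∈ 𝒪[w₁.1.adicCompletion M] ↔
      p ∈ 𝒪[w.1.adicCompletion E] ∧ q ∈ 𝒪[w.1.adicCompletion E])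
    (hs'ι : ∀ x, s' (toPlace w.1 w₁ x) = toPlace w.1 w₁ (galAdicCompletionMap (L := E) c hw x)) (hs'α : s' α = α)
    (hs'O : ∀ z : 𝒪[w₁.1.adicCompletion M], s' z ∈ 𝒪[w₁.1.adicCompletion M]) (hs'v : ∀ z, Valued.v (s' z) = Valued.v z)
    (hnorm1 : ∀ c₁ : w₁.1.adicCompletion M, c₁ ≠ 0 → s' c₁ = c₁ → Even (WithZero.log (Valued.v c₁)) → ∃ a : w₁.1.adicCompletion M, a * s' a * c₁ = 1)
    -- the type-(2) eigen-data of a deep match and the two package clauses on `λ₁ = e₂(t + yα)`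
    (u t D y e₂ : w.1.adicCompletion E) (hu1 : Valued.v (u - 1) < 1) (h2e : e₂ * 2 = 1)
    (hD : 4 * D = t * t - y * y * toPlace v w d)
    (hσu : u * galAdicCompletionMap (L := E) c hw u = 1) (hσD : D * galAdicCompletionMap (L := E) c hw D = 1)
    (hσt : galAdicCompletionMap (L := E) c hw t = t * galAdicCompletionMap (L := E) c hw D)
    (hσy : galAdicCompletionMap (L := E) c hw y = -(y * galAdicCompletionMap (L := E) c hw D))
    {n N : ℕ} (hn : Valued.v (u * u - t * u + D) = WithZero.exp (-(n : ℤ))) (hN : Valued.v y = WithZero.exp (-(N : ℤ)))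
    (hχ1 : Valued.v (1 - t + D) < 1)
    (hlamO : (toPlace w.1 w₁ t + toPlace w.1 w₁ y * α) * toPlace w.1 w₁ e₂ ∈ 𝒪[w₁.1.adicCompletion M])
    (hlam1 : Valued.v ((toPlace w.1 w₁ t + toPlace w.1 w₁ y * α) * toPlace w.1 w₁ e₂ - 1) < 1)
    (hNn : 1 ≤ N + k - e + n) :
    ∃ (ιO : 𝒪[v.adicCompletion F] →+* 𝒪[w.1.adicCompletion E]) (σO : 𝒪[w.1.adicCompletion E] →+* 𝒪[w.1.adicCompletion E]) (jO : 𝒪[w.1.adicCompletion E] →+* 𝒪[w₁.1.adicCompletion M]) (σ₁O : 𝒪[w₁.1.adicCompletion M] →+* 𝒪[w₁.1.adicCompletion M])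
      (uO tO yO DO pO qO : 𝒪[w.1.adicCompletion E]) (lamO piO : 𝒪[w₁.1.adicCompletion M]),
      (∀ x : 𝒪[v.adicCompletion F], ((ιO x : 𝒪[w.1.adicCompletion E]) : w.1.adicCompletion E) = toPlace v w x) ∧
      (∀ x : 𝒪[w.1.adicCompletion E], ((σO x : 𝒪[w.1.adicCompletion E]) : w.1.adicCompletion E) = galAdicCompletionMap (L := E) c hw x) ∧
      (∀ x : 𝒪[w.1.adicCompletion E], ((jO x : 𝒪[w₁.1.adicCompletion M]) : w₁.1.adicCompletion M) = toPlace w.1 w₁ x) ∧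
      (∀ z : 𝒪[w₁.1.adicCompletion M], ((σ₁O z : 𝒪[w₁.1.adicCompletion M]) : w₁.1.adicCompletion M) = s' z) ∧
      (uO : w.1.adicCompletion E) = u ∧ (tO : w.1.adicCompletion E) = t ∧ (yO : w.1.adicCompletion E) = y ∧ (DO : w.1.adicCompletion E) = D ∧
      (pO : w.1.adicCompletion E) = e₂ * (t + y) ∧ (qO : w.1.adicCompletion E) = e₂ * y * toPlace v w ϖ ^ k ∧
      (piO : w₁.1.adicCompletion M) = (α - 1) / toPlace w.1 w₁ (toPlace v w ϖ) ^ k ∧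
      (lamO : w₁.1.adicCompletion M) = (toPlace w.1 w₁ t + toPlace w.1 w₁ y * α) * toPlace w.1 w₁ e₂ ∧ lamO = jO pO + jO qO * piO ∧ e ≤ N + k ∧
      (Units.map ((Polynomial.eval₂RingHom (RingHom.prod (RingHom.id 𝒪[w.1.adicCompletion E]) jO) ((uO, lamO) : 𝒪[w.1.adicCompletion E] × 𝒪[w₁.1.adicCompletion M])).range.subtype :
          (Polynomial.eval₂RingHom (RingHom.prod (RingHom.id 𝒪[w.1.adicCompletion E]) jO) ((uO, lamO) : 𝒪[w.1.adicCompletion E] × 𝒪[w₁.1.adicCompletion M])).range →* 𝒪[w.1.adicCompletion E] × 𝒪[w₁.1.adicCompletion M])).range.relIndex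
        ((Units.map ((Polynomial.eval₂RingHom (RingHom.prod (RingHom.id 𝒪[w.1.adicCompletion E]) jO) ((uO, lamO) : 𝒪[w.1.adicCompletion E] × 𝒪[w₁.1.adicCompletion M])).range.subtype :
          (Polynomial.eval₂RingHom (RingHom.prod (RingHom.id 𝒪[w.1.adicCompletion E]) jO) ((uO, lamO) : 𝒪[w.1.adicCompletion E] × 𝒪[w₁.1.adicCompletion M])).range →* 𝒪[w.1.adicCompletion E] × 𝒪[w₁.1.adicCompletion M])).range.comap
          (MonoidHom.id (𝒪[w.1.adicCompletion E] × 𝒪[w₁.1.adicCompletion M])ˣ * Units.map (RingHom.prodMap σO σ₁O : 𝒪[w.1.adicCompletion E] × 𝒪[w₁.1.adicCompletion M] →* 𝒪[w.1.adicCompletion E] × 𝒪[w₁.1.adicCompletion M]))) =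
        (Ideal.absNorm v.asIdeal + 1) * Ideal.absNorm v.asIdeal ^ (N + k - e + n - 1) := by
  -- ### 0. Notation-free abbreviations and the valuation bridges (as ★ (D5))
  have hσv : ∀ x : w.1.adicCompletion E, Valued.v (galAdicCompletionMap (L := E) c hw x) = Valued.v x :=
    fun x => valued_galAdicCompletionMap (L := E) c hw x
  have hιv : ∀ y : v.adicCompletion F, Valued.v (toPlace v w y) = Valued.v y :=
    fun y => Literature.NumberTheory.Automorphic.Liu2021.LemD1IndexedNonVacuityInertCofinite.valued_toPlace_of_isUnramifiedIn E v hunr w y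
  have hσσK : ∀ x : w.1.adicCompletion E, galAdicCompletionMap (L := E) c hw (galAdicCompletionMap (L := E) c hw x) = x :=
    galAdicCompletionMap_galAdicCompletionMap_of_smul_eq c w hc hw
  have hcc : c * c = 1 := algEquiv_mul_self_eq_one (F := F) hc
  have hsq : ∀ x : WithZero (Multiplicative ℤ), x * x = 1 → x = 1 := fun x h => by
    rcases eq_or_ne x 0 with h0 | h0
    · rw [h0, zero_mul] at h; exact absurd h zero_ne_one
    · rw [← WithZero.exp_log h0, ← WithZero.exp_add, WithZero.exp_eq_one] at h
      rw [← WithZero.exp_log h0, show WithZero.log x = 0 by omega, WithZero.exp_zero]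
  have hunitE : ∀ x : 𝒪[w.1.adicCompletion E], IsUnit x ↔ Valued.v (x : w.1.adicCompletion E) = 1 := fun x => by
    rw [(Valuation.integer.integers (valuation (w.1.adicCompletion E))).isUnit_iff_valuation_eq_one, v_eq_one_iff_valuation_eq_one]; rfl
  have hunitF : ∀ x : 𝒪[v.adicCompletion F], IsUnit x ↔ Valued.v (x : v.adicCompletion F) = 1 := fun x => by
    rw [(Valuation.integer.integers (valuation (v.adicCompletion F))).isUnit_iff_valuation_eq_one, v_eq_one_iff_valuation_eq_one]; rfl
  have hunitK : ∀ x : 𝒪[w₁.1.adicCompletion M], IsUnit x ↔ Valued.v (x : w₁.1.adicCompletion M) = 1 := fun x => by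
    rw [(Valuation.integer.integers (valuation (w₁.1.adicCompletion M))).isUnit_iff_valuation_eq_one, v_eq_one_iff_valuation_eq_one]; rfl
  have hmaxE : ∀ x : 𝒪[w.1.adicCompletion E], Valued.v (x : w.1.adicCompletion E) < 1 → x ∈ IsLocalRing.maximalIdeal 𝒪[w.1.adicCompletion E] :=
    fun x hx => by rw [IsLocalRing.mem_maximalIdeal, mem_nonunits_iff, hunitE]; exact hx.ne
  have hmaxF : ∀ x : 𝒪[v.adicCompletion F], Valued.v (x : v.adicCompletion F) < 1 → x ∈ IsLocalRing.maximalIdeal 𝒪[v.adicCompletion F] :=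
    fun x hx => by rw [IsLocalRing.mem_maximalIdeal, mem_nonunits_iff, hunitF]; exact hx.ne
  -- ### 1. The dyadic arithmetic of the level: `k < e`, `|e₂| = exp e`, `|q| = exp (e − N − k) ≤ 1`, `e ≤ N + k`
  have hke : k < e := by
    have h4' : Valued.v (4 : v.adicCompletion F) = WithZero.exp (-(2 * (e : ℤ))) := by
      have hz : -(e : ℤ) + -(e : ℤ) = -(2 * (e : ℤ)) := by ring
      rw [show (4 : v.adicCompletion F) = 2 * 2 by norm_num, map_mul, he, ← WithZero.exp_add, hz]
    rw [h4', hw₀, WithZero.exp_lt_exp] at h4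
    omega
  have hϖ0 : ϖ ≠ 0 := fun h0 => by rw [h0, map_zero] at hϖ; exact WithZero.zero_ne_coe hϖ
  have hιϖ0 : toPlace v w ϖ ≠ 0 := (_root_.map_ne_zero (toPlace v w)).2 hϖ0
  have hι₁ϖ0 : toPlace w.1 w₁ (toPlace v w ϖ) ^ k ≠ 0 := pow_ne_zero _ ((_root_.map_ne_zero (toPlace w.1 w₁)).2 hιϖ0)
  have h2v : Valued.v (2 : w.1.adicCompletion E) = WithZero.exp (-(e : ℤ)) := by rw [← map_ofNat (toPlace v w) 2, hιv, he]
  have he₂v : Valued.v e₂ = WithZero.exp (e : ℤ) := by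
    have h := congrArg Valued.v h2e
    rw [map_mul, h2v, map_one] at h
    calc Valued.v e₂ = Valued.v e₂ * (WithZero.exp (-(e : ℤ)) * WithZero.exp (e : ℤ)) := by rw [← WithZero.exp_add, neg_add_cancel, WithZero.exp_zero, mul_one]
      _ = WithZero.exp (e : ℤ) := by rw [← mul_assoc, h, one_mul]
  have hsmul : ∀ m : ℕ, m • (-1 : ℤ) = -(m : ℤ) := fun m => by simp
  have hιϖk : Valued.v (toPlace v w ϖ ^ k) = WithZero.exp (-(k : ℤ)) := by
    rw [map_pow, hιv, hϖ, ← WithZero.exp_nsmul, hsmul]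
  have hqv : Valued.v (e₂ * y * toPlace v w ϖ ^ k) = WithZero.exp ((e : ℤ) - N - k) := by
    have hz : (e : ℤ) + -(N : ℤ) + -(k : ℤ) = (e : ℤ) - N - k := by ring
    rw [map_mul, map_mul, he₂v, hN, hιϖk, ← WithZero.exp_add, ← WithZero.exp_add, hz]
  -- the coordinates of `λ₁` on `(1, Π)`: `p = e₂ (t + y)`, `q = e₂ y ιϖ^k`
  have hPidef : toPlace w.1 w₁ (toPlace v w ϖ) ^ k * ((α - 1) / toPlace w.1 w₁ (toPlace v w ϖ) ^ k) = α - 1 := mul_div_cancel₀ _ hι₁ϖ0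
  have hlam_coord : (toPlace w.1 w₁ t + toPlace w.1 w₁ y * α) * toPlace w.1 w₁ e₂ =
      toPlace w.1 w₁ (e₂ * (t + y)) + toPlace w.1 w₁ (e₂ * y * toPlace v w ϖ ^ k) * ((α - 1) / toPlace w.1 w₁ (toPlace v w ϖ) ^ k) := by
    rw [map_mul (toPlace w.1 w₁) (e₂ * y), map_pow, mul_assoc (toPlace w.1 w₁ (e₂ * y)), hPidef, map_mul, map_mul, map_add]; ring
  have hpqO : e₂ * (t + y) ∈ 𝒪[w.1.adicCompletion E] ∧ e₂ * y * toPlace v w ϖ ^ k ∈ 𝒪[w.1.adicCompletion E] :=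
    (hint _ _).1 (hlam_coord ▸ hlamO)
  have heNk : e ≤ N + k := by
    have h := (v_le_one_iff_mem_integer _).2 hpqO.2
    rw [hqv, ← WithZero.exp_zero, WithZero.exp_le_exp] at h
    omega
  -- ### 2. Integrality of the remaining data
  have hle_of_sub : ∀ {x c₀ : w.1.adicCompletion E}, Valued.v (x - c₀) < 1 → Valued.v c₀ ≤ 1 → Valued.v x ≤ 1 := fun {x c₀} hx hc₀ => by
    have := Valued.v.map_add_le hx.le hc₀; rwa [sub_add_cancel] at this
  have huO : u ∈ 𝒪[w.1.adicCompletion E] := (v_le_one_iff_mem_integer u).1 (hle_of_sub hu1 (by rw [map_one]))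
  have hDv : Valued.v D = 1 := hsq _ (by have h := congrArg Valued.v hσD; rwa [map_mul, hσv, map_one] at h)
  have hDO : D ∈ 𝒪[w.1.adicCompletion E] := (v_le_one_iff_mem_integer D).1 hDv.le
  have htO : t ∈ 𝒪[w.1.adicCompletion E] := (v_le_one_iff_mem_integer t).1 (by
    have h1 : Valued.v (t - (1 + D)) < 1 := by rw [← Valuation.map_neg, neg_sub, show 1 + D - t = 1 - t + D by ring]; exact hχ1
    exact hle_of_sub h1 (le_trans (Valuation.map_add _ _ _) (max_le (by rw [map_one]) hDv.le)))
  have hyO : y ∈ 𝒪[w.1.adicCompletion E] := (v_le_one_iff_mem_integer y).1 (by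
    rw [hN, ← WithZero.exp_zero]; exact WithZero.exp_le_exp.2 (by omega))
  have hpiO : (α - 1) / toPlace w.1 w₁ (toPlace v w ϖ) ^ k ∈ 𝒪[w₁.1.adicCompletion M] := by
    have h := (hint 0 1).2 ⟨zero_mem _, one_mem _⟩
    rwa [map_zero, map_one, zero_add, one_mul] at h
  -- the Eisenstein coefficients `a = −2∕ϖ^k`, `k₀ = w₀∕ϖ^{2k}` of `Π² = ι(a)Π + ι(k₀)`, both in `𝔪_v`
  have hav : Valued.v (-2 / ϖ ^ k) = WithZero.exp ((k : ℤ) - e) := by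
    have hz : -(e : ℤ) - -(k : ℤ) = (k : ℤ) - e := by ring
    rw [map_div₀, Valuation.map_neg, he, map_pow, hϖ, ← WithZero.exp_nsmul, hsmul, ← WithZero.exp_sub, hz]
  have haO : -2 / ϖ ^ k ∈ 𝒪[v.adicCompletion F] := (v_le_one_iff_mem_integer _).1 (by
    rw [hav, ← WithZero.exp_zero]; exact WithZero.exp_le_exp.2 (by omega))
  have hk₀v : Valued.v (w₀ / (ϖ ^ k) ^ 2) = WithZero.exp (-1 : ℤ) := by
    have hz : -(2 * (k : ℤ) + 1) - (2 : ℕ) • (-(k : ℤ)) = -1 := by simp only [nsmul_eq_mul]; push_cast; ring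
    rw [map_div₀, map_pow, map_pow, hw₀, hϖ, ← WithZero.exp_nsmul, hsmul, ← WithZero.exp_nsmul, ← WithZero.exp_sub, hz]
  have hk₀O : w₀ / (ϖ ^ k) ^ 2 ∈ 𝒪[v.adicCompletion F] := (v_le_one_iff_mem_integer _).1 (by
    rw [hk₀v, ← WithZero.exp_zero]; exact WithZero.exp_le_exp.2 (by norm_num))
  have hPisq : ((α - 1) / toPlace w.1 w₁ (toPlace v w ϖ) ^ k) ^ 2 =
      toPlace w.1 w₁ (toPlace v w (-2 / ϖ ^ k)) * ((α - 1) / toPlace w.1 w₁ (toPlace v w ϖ) ^ k) + toPlace w.1 w₁ (toPlace v w (w₀ / (ϖ ^ k) ^ 2)) := by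
    have hα' : α ^ 2 = 1 + toPlace w.1 w₁ (toPlace v w w₀) := by rw [hα, hdw]; simp only [map_add, map_one]
    simp only [map_div₀, map_neg, map_ofNat, map_pow]
    linear_combination (1 / toPlace w.1 w₁ (toPlace v w ϖ) ^ k) ^ 2 * hα'
  -- ### 3. The integral ring maps and the integral lifts
  obtain ⟨ιO, hιO⟩ := exists_integer_ringHom_toPlace v w
  obtain ⟨jO, hjO⟩ := exists_integer_ringHom_toPlace w.1 w₁
  obtain ⟨σO, hσO⟩ := exists_integer_ringHom_of_map_mem_integer (galAdicCompletionMap (L := E) c hw) (mem_integer_galAdicCompletionMap c v w hw)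
  obtain ⟨σ₁O, hσ₁O⟩ := exists_integer_ringHom_of_map_mem_integer s' hs'O
  obtain ⟨uO, huO'⟩ : ∃ uO : 𝒪[w.1.adicCompletion E], (uO : w.1.adicCompletion E) = u := ⟨⟨u, huO⟩, rfl⟩
  obtain ⟨tO, htO'⟩ : ∃ tO : 𝒪[w.1.adicCompletion E], (tO : w.1.adicCompletion E) = t := ⟨⟨t, htO⟩, rfl⟩
  obtain ⟨yO, hyO'⟩ : ∃ yO : 𝒪[w.1.adicCompletion E], (yO : w.1.adicCompletion E) = y := ⟨⟨y, hyO⟩, rfl⟩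
  obtain ⟨DO, hDO'⟩ : ∃ DO : 𝒪[w.1.adicCompletion E], (DO : w.1.adicCompletion E) = D := ⟨⟨D, hDO⟩, rfl⟩
  obtain ⟨pO, hpO'⟩ : ∃ pO : 𝒪[w.1.adicCompletion E], (pO : w.1.adicCompletion E) = e₂ * (t + y) := ⟨⟨_, hpqO.1⟩, rfl⟩
  obtain ⟨qO, hqO'⟩ : ∃ qO : 𝒪[w.1.adicCompletion E], (qO : w.1.adicCompletion E) = e₂ * y * toPlace v w ϖ ^ k := ⟨⟨_, hpqO.2⟩, rfl⟩
  obtain ⟨piO, hpiO'⟩ : ∃ piO : 𝒪[w₁.1.adicCompletion M], (piO : w₁.1.adicCompletion M) = (α - 1) / toPlace w.1 w₁ (toPlace v w ϖ) ^ k := ⟨⟨_, hpiO⟩, rfl⟩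
  obtain ⟨aF, haF'⟩ : ∃ aF : 𝒪[v.adicCompletion F], (aF : v.adicCompletion F) = -2 / ϖ ^ k := ⟨⟨_, haO⟩, rfl⟩
  obtain ⟨k₀F, hk₀F'⟩ : ∃ k₀F : 𝒪[v.adicCompletion F], (k₀F : v.adicCompletion F) = w₀ / (ϖ ^ k) ^ 2 := ⟨⟨_, hk₀O⟩, rfl⟩
  obtain ⟨lamO, hlamOdef⟩ : ∃ lamO : 𝒪[w₁.1.adicCompletion M], lamO = jO pO + jO qO * piO := ⟨_, rfl⟩
  have hlamO' : (lamO : w₁.1.adicCompletion M) = (toPlace w.1 w₁ t + toPlace w.1 w₁ y * α) * toPlace w.1 w₁ e₂ := by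
    rw [hlamOdef, Subring.coe_add, Subring.coe_mul, hjO, hjO, hpO', hqO', hpiO', hlam_coord]
  -- ### 4. The dictionary binders of (L3′) `relIndex_units_comap_norm_eq_eisenstein`
  have hσσ : ∀ x, σO (σO x) = x := fun x => Subtype.ext (by rw [hσO, hσO, hσσK])
  have hσι : ∀ y', σO (ιO y') = ιO y' := fun y' => Subtype.ext (by rw [hσO, hιO, galAdicCompletionMap_toPlace c w w hw])
  have hfixO : ∀ x, σO x = x → ∃ y', ιO y' = x := fun x hx =>
    exists_map_eq_of_galAdicCompletionMap_eq v w c hc hw ιO hιO x (by rw [← hσO, hx])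
  have hιinj : Function.Injective ιO := injective_of_coe_eq_toPlace v w ιO hιO
  have hιu : ∀ y', IsUnit (ιO y') → IsUnit y' := fun y' h => by
    rw [hunitF]; rw [hunitE, hιO, hιv] at h; exact h
  have hσ₁j : ∀ x, σ₁O (jO x) = jO (σO x) := fun x => Subtype.ext (by rw [hσ₁O, hjO, hjO, hσO, hs'ι])
  have hs'Pi : s' ((α - 1) / toPlace w.1 w₁ (toPlace v w ϖ) ^ k) = (α - 1) / toPlace w.1 w₁ (toPlace v w ϖ) ^ k := by
    rw [map_div₀, map_sub, map_one, hs'α, map_pow, hs'ι, galAdicCompletionMap_toPlace c w w hw]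
  have hσ₁θ : σ₁O piO = piO := Subtype.ext (by rw [hσ₁O, hpiO']; exact hs'Pi)
  have hθ' : piO ^ 2 = jO (ιO aF) * piO + jO (ιO k₀F) :=
    Subtype.ext (by rw [Subring.coe_pow, Subring.coe_add, Subring.coe_mul, hjO, hjO, hιO, hιO, hpiO', haF', hk₀F']; exact hPisq)
  have haF : aF ∈ IsLocalRing.maximalIdeal 𝒪[v.adicCompletion F] := hmaxF _ (by
    rw [haF', hav, ← WithZero.exp_zero]; exact WithZero.exp_lt_exp.2 (by omega))
  have hk₀ : k₀F ∈ IsLocalRing.maximalIdeal 𝒪[v.adicCompletion F] := hmaxF _ (by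
    rw [hk₀F', hk₀v, ← WithZero.exp_zero]; exact WithZero.exp_lt_exp.2 (by norm_num))
  have hcoordO : ∀ z : 𝒪[w₁.1.adicCompletion M], ∃! bc : 𝒪[w.1.adicCompletion E] × 𝒪[w.1.adicCompletion E], z = jO bc.1 + jO bc.2 * piO := by
    intro z
    obtain ⟨⟨p, q⟩, hz, huniq⟩ := hcoord (z : w₁.1.adicCompletion M)
    have hpq : p ∈ 𝒪[w.1.adicCompletion E] ∧ q ∈ 𝒪[w.1.adicCompletion E] := (hint p q).1 (hz ▸ z.2)
    refine ⟨(⟨p, hpq.1⟩, ⟨q, hpq.2⟩), Subtype.ext ?_, fun bc hbc => ?_⟩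
    · rw [Subring.coe_add, Subring.coe_mul, hjO, hjO, hpiO']; exact hz
    · have hbc' : (z : w₁.1.adicCompletion M) = toPlace w.1 w₁ bc.1 + toPlace w.1 w₁ bc.2 * ((α - 1) / toPlace w.1 w₁ (toPlace v w ϖ) ^ k) := by
        have := congrArg (fun x : 𝒪[w₁.1.adicCompletion M] => (x : w₁.1.adicCompletion M)) hbc
        simp only [Subring.coe_add, Subring.coe_mul, hjO, hpiO'] at this
        exact this
      have h := huniq (((bc.1 : w.1.adicCompletion E)), (bc.2 : w.1.adicCompletion E)) hbc'
      rw [Prod.mk.injEq] at h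
      exact Prod.ext (Subtype.ext h.1) (Subtype.ext h.2)
  -- the quadratic relation of `λ₁` (in the field: `e₂·2 = 1`, `4D = t² − y²d`, `α² = d`)
  have h2e' : toPlace w.1 w₁ e₂ * 2 = 1 := by
    have := congrArg (toPlace w.1 w₁) h2e; rwa [map_mul, map_ofNat, map_one] at this
  have hD₁ : 4 * toPlace w.1 w₁ D = toPlace w.1 w₁ t * toPlace w.1 w₁ t - toPlace w.1 w₁ y * toPlace w.1 w₁ y * α ^ 2 := by
    have := congrArg (toPlace w.1 w₁) hD; rw [map_mul, map_ofNat, map_sub, map_mul, map_mul, map_mul] at this; rw [this, hα]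
  have hlamroot : ((toPlace w.1 w₁ t + toPlace w.1 w₁ y * α) * toPlace w.1 w₁ e₂) ^ 2
      - toPlace w.1 w₁ t * ((toPlace w.1 w₁ t + toPlace w.1 w₁ y * α) * toPlace w.1 w₁ e₂) + toPlace w.1 w₁ D = 0 := by
    linear_combination (toPlace w.1 w₁ e₂ ^ 2) * hD₁ +
      (toPlace w.1 w₁ e₂ * toPlace w.1 w₁ t * (toPlace w.1 w₁ t + toPlace w.1 w₁ y * α) - (1 + 2 * toPlace w.1 w₁ e₂) * toPlace w.1 w₁ D) * h2e'
  have hlam2 : lamO ^ 2 - jO tO * lamO + jO DO = 0 := Subtype.ext (by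
    push_cast; rw [hjO, hjO, hlamO', htO', hDO']; exact hlamroot)
  have hlam' : lamO = jO pO + jO qO * piO := hlamOdef
  -- locality binders
  have hu1' : uO - 1 ∈ IsLocalRing.maximalIdeal 𝒪[w.1.adicCompletion E] := hmaxE _ (by push_cast; rw [huO']; exact hu1)
  have hχ1' : 1 - tO + DO ∈ IsLocalRing.maximalIdeal 𝒪[w.1.adicCompletion E] := hmaxE _ (by push_cast; rw [htO', hDO']; exact hχ1)
  have hp1' : pO - 1 ∈ IsLocalRing.maximalIdeal 𝒪[w.1.adicCompletion E] := by
    have ha' : ιO aF ∈ IsLocalRing.maximalIdeal 𝒪[w.1.adicCompletion E] := map_k₀_mem_maximalIdeal ιO hιu haF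
    have hk' : ιO k₀F ∈ IsLocalRing.maximalIdeal 𝒪[w.1.adicCompletion E] := map_k₀_mem_maximalIdeal ιO hιu hk₀
    have hnu : ¬ IsUnit (lamO - 1) := by
      rw [hunitK, AddSubgroupClass.coe_sub, Subring.coe_one, hlamO']; exact hlam1.ne
    rw [hlam', show jO pO + jO qO * piO - 1 = jO (pO - 1) + jO qO * piO by rw [map_sub, map_one]; ring,
      isUnit_add_mul_iff_eisenstein jO piO hθ' ha' hk' hcoordO] at hnu
    exact (IsLocalRing.mem_maximalIdeal _).2 (mem_nonunits_iff.2 hnu)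
  -- unitarity of the generator: `u σu = 1`, `λ₁ s'λ₁ = e₂² σD (t² − y²d) = 1`
  have hσlam : (toPlace w.1 w₁ t + toPlace w.1 w₁ y * α) * toPlace w.1 w₁ e₂ * s' ((toPlace w.1 w₁ t + toPlace w.1 w₁ y * α) * toPlace w.1 w₁ e₂) = 1 := by
    have hs'e₂ : s' (toPlace w.1 w₁ e₂) = toPlace w.1 w₁ e₂ := by
      have hσe₂ : galAdicCompletionMap (L := E) c hw e₂ = e₂ := by
        have h1 : galAdicCompletionMap (L := E) c hw e₂ * 2 = 1 := by
          have := congrArg (galAdicCompletionMap (L := E) c hw) h2e; rwa [map_mul, map_ofNat, map_one] at this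
        calc galAdicCompletionMap (L := E) c hw e₂ = galAdicCompletionMap (L := E) c hw e₂ * (e₂ * 2) := by rw [h2e, mul_one]
          _ = (galAdicCompletionMap (L := E) c hw e₂ * 2) * e₂ := by ring
          _ = e₂ := by rw [h1, one_mul]
      rw [hs'ι, hσe₂]
    have hσD₁ : toPlace w.1 w₁ D * toPlace w.1 w₁ (galAdicCompletionMap (L := E) c hw D) = 1 := by rw [← map_mul, hσD, map_one]
    rw [map_mul, map_add, map_mul, hs'e₂, hs'ι, hs'ι, hs'α, hσt, hσy, map_mul, map_neg, map_mul]
    linear_combination (-(toPlace w.1 w₁ e₂ ^ 2 * toPlace w.1 w₁ (galAdicCompletionMap (L := E) c hw D))) * hD₁ +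
      ((2 * toPlace w.1 w₁ e₂ + 1) * toPlace w.1 w₁ D * toPlace w.1 w₁ (galAdicCompletionMap (L := E) c hw D)) * h2e' + hσD₁
  have hxstar : ((uO, lamO) : 𝒪[w.1.adicCompletion E] × 𝒪[w₁.1.adicCompletion M]) * RingHom.prodMap σO σ₁O (uO, lamO) = 1 := by
    change ((uO, lamO) : 𝒪[w.1.adicCompletion E] × 𝒪[w₁.1.adicCompletion M]) * (σO uO, σ₁O lamO) = 1
    rw [Prod.mk_mul_mk, Prod.mk_eq_one]
    exact ⟨Subtype.ext (by rw [Subring.coe_mul, hσO, huO', Subring.coe_one]; exact hσu),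
      Subtype.ext (by rw [Subring.coe_mul, hσ₁O, hlamO', Subring.coe_one]; exact hσlam)⟩
  -- unit norms (nE), (nK): verbatim from ★ (D5)
  have hnormE : ∀ a : 𝒪[w.1.adicCompletion E], IsUnit a → σO a = a → ∃ b, b * σO b = a := fun a ha hσa => by
    obtain ⟨b, hb⟩ := LocalFields.UnramifiedQuadraticNorm.exists_mul_galAdicCompletionMap_eq_of_inert c v hc hcc hunr w hw a ha
      (by have := congrArg (fun x : 𝒪[w.1.adicCompletion E] => (x : w.1.adicCompletion E)) hσa; rwa [hσO] at this)
    exact ⟨b, Subtype.ext (by rw [Subring.coe_mul, hσO]; exact hb)⟩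
  have hnorm₁ : ∀ z : 𝒪[w₁.1.adicCompletion M], IsUnit z → σ₁O z = z → ∃ w', w' * σ₁O w' = z := fun z hz hσz => by
    have hz1 : Valued.v (z : w₁.1.adicCompletion M) = 1 := (hunitK z).1 hz
    have hz0 : (z : w₁.1.adicCompletion M) ≠ 0 := fun h0 => by rw [h0, map_zero] at hz1; exact zero_ne_one hz1
    have hσz' : s' (z : w₁.1.adicCompletion M) = z := by
      have := congrArg (fun x : 𝒪[w₁.1.adicCompletion M] => (x : w₁.1.adicCompletion M)) hσz; rwa [hσ₁O] at this
    obtain ⟨a, ha⟩ := hnorm1 z hz0 hσz' (by rw [hz1, WithZero.log_one]; exact ⟨0, rfl⟩)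
    have hav' : Valued.v a = 1 := hsq _ (by
      have h := congrArg Valued.v ha
      rwa [map_mul, map_mul, hs'v, hz1, mul_one, map_one] at h)
    have ha0 : a ≠ 0 := fun h0 => by rw [h0, map_zero] at hav'; exact zero_ne_one hav'
    have haO' : a⁻¹ ∈ 𝒪[w₁.1.adicCompletion M] := (v_le_one_iff_mem_integer _).1 (by rw [map_inv₀, hav', inv_one])
    refine ⟨⟨a⁻¹, haO'⟩, Subtype.ext ?_⟩
    rw [Subring.coe_mul, hσ₁O]
    change a⁻¹ * s' a⁻¹ = (z : w₁.1.adicCompletion M)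
    rw [map_inv₀, ← mul_inv, ← mul_right_inj' (mul_ne_zero ha0 ((map_ne_zero s').2 ha0)), mul_inv_cancel₀ (mul_ne_zero ha0 ((map_ne_zero s').2 ha0)), ha]
  -- uniformisers, valuations of the eigen-data (level `N + k − e`)
  have hϖF : IsUniformizingElement ϖ := isUniformizingElement_of_v_eq hϖ
  have hιϖv : Valued.v (toPlace v w ϖ) = WithZero.exp (-1 : ℤ) := by rw [hιv, hϖ]
  have hϖE : IsUniformizingElement (toPlace v w ϖ) := isUniformizingElement_of_v_eq hιϖv
  have hιϖ : ιO ⟨ϖ, hϖF.mem⟩ = ⟨toPlace v w ϖ, hϖE.mem⟩ := Subtype.ext (hιO _)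
  have hpow : ∀ m : ℕ, Valued.v (toPlace v w ϖ ^ m) = WithZero.exp (-(m : ℤ)) := fun m => by
    rw [map_pow, hιϖv, ← WithZero.exp_nsmul, hsmul]
  have hn' : valuation (w.1.adicCompletion E) ((uO * uO - tO * uO + DO : 𝒪[w.1.adicCompletion E]) : w.1.adicCompletion E) =
      valuation (w.1.adicCompletion E) (toPlace v w ϖ) ^ n := by
    rw [← map_pow, ← v_eq_iff_valuation_eq, hpow]; push_cast; rw [huO', htO', hDO']; exact hn
  have hN' : valuation (w.1.adicCompletion E) ((qO : 𝒪[w.1.adicCompletion E]) : w.1.adicCompletion E) =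
      valuation (w.1.adicCompletion E) (toPlace v w ϖ) ^ (N + k - e) := by
    have hz : (e : ℤ) - N - k = -((N + k - e : ℕ) : ℤ) := by push_cast [heNk]; ring
    rw [← map_pow, ← v_eq_iff_valuation_eq, hpow, hqO', hqv, hz]
  have hq : Nat.card 𝓀[w.1.adicCompletion E] = Nat.card 𝓀[v.adicCompletion F] ^ 2 := natCard_residueField_eq_natCard_residueField_sq c v hc hunr w hw
  obtain ⟨ξ, hξ0⟩ := exists_isUnit_galAdicCompletionMap_sub c v hc hunr w hw
  have hξ : IsUnit (ξ - σO ξ) := by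
    have h := hξ0.neg
    rw [neg_sub] at h
    have hσOξ : σO ξ = ⟨galAdicCompletionMap (L := E) c hw ξ, mem_integer_galAdicCompletionMap c v w hw ξ⟩ := Subtype.ext (hσO ξ)
    rw [hσOξ]
    exact h
  -- ### 5. Assembly
  refine ⟨ιO, σO, jO, σ₁O, uO, tO, yO, DO, pO, qO, lamO, piO, hιO, hσO, hjO, hσ₁O, huO', htO', hyO', hDO', hpO', hqO', hpiO', hlamO', hlam', heNk, ?_⟩
  rw [← natCard_residueField_eq_absNorm v]
  exact relIndex_units_comap_norm_eq_eisenstein ιO σO jO σ₁O piO uO hσσ hσι hfixO hιinj hιu hσ₁j hσ₁θ hθ' haF hk₀ hcoordO hlam' hlam2 hu1' hp1' hχ1' hxstar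
    hnormE hnorm₁ hϖF hϖE hιϖ hn' hN' hq hξ hNn

end Literature.NumberTheory.Rogawski1990

end
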